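import Summits.ResolutionOfSingularities.ResolutionOfSingularities.Theorems.PurelyInseparableDim4AtlasSurvivalChartL
import Summits.ResolutionOfSingularities.ResolutionOfSingularities.Theorems.PurelyInseparableDim4AtlasSurvival
import Summits.ResolutionOfSingularities.ResolutionOfSingularities.Theorems.PurelyInseparableDim4AtlasMemberDefsFour
import HarnessLib

/-!
# Purely inseparable four-folds: an ATLAS MEMBER WITH LETTERS SURVIVES the blow-up of a disjoint centre (brick S3 (c) v4, tranche 2, brick A2⁺;
# cell `res-dim4-pi`)

[OURS · counted 0] (D-0157 DOOR 2; host item stmt-ResolutionOfSingularities-16155, helper). Nothing here proves resolution of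
singularities in dimension ≥ 4 / characteristic `p`. Tranche-2 twin of A2 `memberDataAT_survival` (p718148): if `π : W → X′` blows up a centre
`Ce` disjoint from an atlas member `c` carrying `MemberDataAL` (DefsFour), then `π⁻¹c` carries `MemberDataAL` for the transformed marked ideal
with the SAME readings and letters (`reading_survival_zigzag_letters`). Proof = p718148's, verbatim.

* `coe_member_subset_support_of_atlasZL`, **`memberDataAL_survival`** (= hypothesis (SURV) of the generic node theorem p724734 for `MemberDataAL`).

AI-produced formalisation, weaker than expert review. bears_on: LADDER-RESOLUTION:D157-DOOR2 (res-dim4-pi · S3 (c) v4 tranche 2 A2⁺).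
-/
set_option linter.dupNamespace false -- D-0017: single-problem summit path `Summit.<S>.<S>.…` by design

noncomputable section

open MvPolynomial Finset CategoryTheory AlgebraicGeometry Opposite TopologicalSpace
open AlgebraicGeometry.Scheme.IdealSheafData (ofIdealTop vanishingIdeal)

namespace Summit.ResolutionOfSingularities.ResolutionOfSingularities.Theorems.PIDim4

open Literature.AlgebraicGeometry.Resolution
open Literature.AlgebraicGeometry.Resolution.Hauser2010
open Literature.AlgebraicGeometry.Resolution.AffinePointBlowup (P A γ coord Wtop ξ)

namespace Equimultiple

section SurvivalAL

variable {K : Type} [Field K] {p : ℕ} [hp : Fact p.Prime] [CharP K p] [DecidableEq K]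
variable {X' W Y : Scheme.{0}} {π : W ⟶ X'} {Ce : X'.IdealSheafData}

omit hp [CharP K p] in
/-- **An atlas member with letters lies in the support of the marked ideal** (BGMW Def. 3.1.3 (1)): by the cover of `MemberAtlasZL` and the order of
`z^p + F_r` along `V(z, x_{T_r})` on every reading. [cite: BierstoneGrigorievMilmanWlodarczyk2011, Def. 3.1.3 (1)] -/
theorem coe_member_subset_support_of_atlasZL [IsLocallyNoetherian X'] (M' : MarkedIdeal X') (hmult : M'.mult = p) (c : Closeds X')
    (R : Finset (AReadingL K)) (hatlas : MemberAtlasZL p M' c R) (hperm : ∀ r ∈ R, (p : ℕ∞) ≤ CentreBlowup.ordAlong r.1.2.1 r.1.1.F) :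
    (c : Set X') ⊆ M'.support := by
  obtain ⟨Yc, φ, ψ, hcl, hcov, -⟩ := hatlas
  intro x hx
  obtain ⟨r, y, hy, rfl⟩ := Set.mem_iUnion.mp (hcov hx)
  obtain ⟨_, _, hM, -, -⟩ := hcl r
  have hy' : ψ r y ∈ AffineCoordBlowup.CΛ 4 K (insert 0 (Fin.succ '' (r.1.1.2.1 : Set (Fin 4)))) := by
    have h := hy
    simp only [Set.mem_preimage, ownedSetZ, Set.mem_setOf_eq] at h
    exact h.1
  change (M'.mult : ℕ∞) ≤ idealOrder M'.ideal (φ r y)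
  rw [hmult, ← idealOrder_comap_of_isOpenImmersion (φ r) M'.ideal y, hM, idealOrder_comap_of_isOpenImmersion (ψ r) _ y]
  exact ChartDictionary.le_idealOrder_hypSheaf_of_mem_CΛ p _ _ (hperm r.1 r.2) hy'

/-- **AN ATLAS MEMBER WITH LETTERS SURVIVES THE BLOW-UP OF A DISJOINT CENTRE (A2⁺).** See the module docstring.
[cite: BierstoneGrigorievMilmanWlodarczyk2011, Def. 3.1.3 (2), (4)] [cite: StacksProject, Tag 02OS] -/
theorem memberDataAL_survival [IsAlgClosed K] [IsLocallyNoetherian X'] [IsLocallyNoetherian W] (hπ : IsBlowup π Ce)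
    (M' : MarkedIdeal X') (hmult : M'.mult = p) (hsncC : HasSNCWith M'.boundary Ce) (shr : AReading K → Fin 4 × (Fin 4 → K))
    (plan : AReadingL K → Finset (Fin 4 × (Fin 4 → K) × Finset (Fin 4)))
    (leaves : AReadingL K → Finset (Fin 4 × (Fin 4 → K)))
    (c : Closeds X') (hdisj : Disjoint (c : Set X') (Ce.support : Set X')) {R : Finset (AReadingL K)}
    (h : MemberDataAL p shr plan leaves M' c R) :
    MemberDataAL p shr plan leaves (M'.transform π Ce) (c.preimage π.continuous) R := by
  classical
  obtain ⟨hbasic, hfmt, hreg, hsnc, hatlas, hblocks, hacc⟩ := h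
  have hsub : (c : Set X') ⊆ M'.support :=
    coe_member_subset_support_of_atlasZL M' hmult c R hatlas fun r hr => (hbasic r hr).2.2.2
  obtain ⟨Yc, φ, ψ, hcl, hcov, hdis⟩ := hatlas
  -- global survival
  obtain ⟨hreg', -, hsnc'⟩ := member_survival_global hπ M' c hdisj hreg hsub hsncC hsnc
  -- every reading survives
  have key : ∀ r : ↥R, ∃ (Y' : Scheme.{0}) (φ' : Y' ⟶ W) (ψ' : Y' ⟶ P 4 K) (_ : IsOpenImmersion φ') (_ : IsOpenImmersion ψ'),
      (controlledTransform π Ce M'.ideal M'.mult).comap φ' = (hypSheaf p r.1.1.1.F).comap ψ' ∧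
      (vanishingIdeal (c.preimage π.continuous)).comap φ' =
        (AffineCoordBlowup.𝓘Λ 4 K (insert 0 (Fin.succ '' (r.1.1.2.1 : Set (Fin 4))))).comap ψ' ∧
      (AffineCoordBlowup.CΛ 4 K (insert 0 (Fin.succ '' (r.1.1.2.1 : Set (Fin 4)))) : Set (P 4 K)) ⊆ Set.range ψ' ∧
      (∀ D : Set (P 4 K), D ⊆ Set.range (ψ r) → Disjoint (φ r '' (ψ r ⁻¹' D)) (Ce.support : Set X') →
        D ⊆ Set.range ψ' ∧ φ' '' (ψ' ⁻¹' D) = π ⁻¹' (φ r '' (ψ r ⁻¹' D))) ∧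
      ∃ (idx₂ : W.IdealSheafData → Fin 4) (cst₂ : W.IdealSheafData → K),
        (∀ D₂ ∈ M'.boundary.map (strictTransformIdeal π Ce) ++ [Ce.comap π],
          ((D₂.support : Set W) ∩ φ' '' (ψ' ⁻¹'
            (AffineCoordBlowup.CΛ 4 K (insert 0 (Fin.succ '' (r.1.1.2.1 : Set (Fin 4)))) : Set (P 4 K)))).Nonempty →
          D₂.comap φ' = (ofIdealTop (Ideal.span {(γ 4 K).symm (X (idx₂ D₂).succ + C (cst₂ D₂))})).comap ψ' ∧
            (idx₂ D₂ ∈ r.1.1.2.1 → cst₂ D₂ = 0) ∧ (idx₂ D₂, cst₂ D₂) ∈ r.1.2) ∧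
        (∀ D₁ ∈ M'.boundary.map (strictTransformIdeal π Ce) ++ [Ce.comap π],
          ∀ D₂ ∈ M'.boundary.map (strictTransformIdeal π Ce) ++ [Ce.comap π],
          ((D₁.support : Set W) ∩ φ' '' (ψ' ⁻¹'
            (AffineCoordBlowup.CΛ 4 K (insert 0 (Fin.succ '' (r.1.1.2.1 : Set (Fin 4)))) : Set (P 4 K)))).Nonempty →
          ((D₂.support : Set W) ∩ φ' '' (ψ' ⁻¹'
            (AffineCoordBlowup.CΛ 4 K (insert 0 (Fin.succ '' (r.1.1.2.1 : Set (Fin 4)))) : Set (P 4 K)))).Nonempty →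
          idx₂ D₁ = idx₂ D₂ → D₁ = D₂) := by
    intro r
    obtain ⟨hφ, hψ, hM, hZ, hsee, -, idx, cst_, hshape, hinj⟩ := hcl r
    exact reading_survival_zigzag_letters hπ c hdisj (φ r) (ψ r) M'.ideal (hypSheaf p r.1.1.1.F) hM M'.mult hZ hsee M'.boundary idx cst_
      (fun D hD hne => ⟨(hshape D hD hne).1, (hshape D hD hne).2.1⟩) hinj r.1.2 (fun D hD hne => (hshape D hD hne).2.2)
  choose Y' φ' ψ' hφ' hψ' hM' hZ' hsee' hvis hdict using key
  -- images of parts of `V(z, x_T)` miss the centre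
  have hmiss : ∀ (r : ↥R) (D : Set (P 4 K)), D ⊆ (AffineCoordBlowup.CΛ 4 K (insert 0 (Fin.succ '' (r.1.1.2.1 : Set (Fin 4)))) : Set (P 4 K)) →
      D ⊆ Set.range (ψ r) ∧ Disjoint (φ r '' (ψ r ⁻¹' D)) (Ce.support : Set X') := by
    intro r D hD
    obtain ⟨_, _, -, hZ, hsee, -⟩ := hcl r
    exact ⟨hD.trans hsee, Set.disjoint_of_subset_left (image_preimage_subset_member (φ r) (ψ r) c hZ hD) hdisj⟩
  have hownCΛ : ∀ (T : Finset (Fin 4)) (X : Finset (Fin 4 × K)),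
      ownedSetZ T X ⊆ (AffineCoordBlowup.CΛ 4 K (insert 0 (Fin.succ '' (T : Set (Fin 4)))) : Set (P 4 K)) := by
    intro T X x hx
    simp only [ownedSetZ, Set.mem_setOf_eq] at hx
    exact hx.1
  have hpull : ∀ (r : ↥R) (X : Finset (Fin 4 × K)),
      φ' r '' (ψ' r ⁻¹' ownedSetZ r.1.1.2.1 X) = π ⁻¹' (φ r '' (ψ r ⁻¹' ownedSetZ r.1.1.2.1 X)) := by
    intro r X
    obtain ⟨h1, h2⟩ := hmiss r _ (hownCΛ r.1.1.2.1 X)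
    exact (hvis r _ h1 h2).2
  refine ⟨hbasic, hfmt, hreg', hsnc', ⟨Y', φ', ψ', fun r => ⟨hφ' r, hψ' r, ?_, hZ' r, hsee' r, fun v => ?_, hdict r⟩, ?_, ?_⟩,
    hblocks, hacc⟩
  · rw [MarkedIdeal.transform_ideal]
    exact hM' r
  · -- fibre pieces stay closed
    obtain ⟨_, _, -, -, -, hfib, -⟩ := hcl r
    rw [hpull r]
    exact (hfib v).preimage π.continuous
  · -- the cover
    intro w hw
    have hwc : π w ∈ (c : Set X') := hw
    obtain ⟨r, hr⟩ := Set.mem_iUnion.mp (hcov hwc)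
    refine Set.mem_iUnion.mpr ⟨r, ?_⟩
    rw [hpull r]
    exact hr
  · -- disjointness
    intro r r' hne
    rw [hpull r, hpull r']
    exact (hdis r r' hne).preimage π

end SurvivalAL

end Equimultiple

end Summit.ResolutionOfSingularities.ResolutionOfSingularities.Theorems.PIDim4

end
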